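import Literature.AlgebraicGeometry.Motives.QuadricsFiniteFieldCohomology
import Literature.AlgebraicGeometry.Motives.QuadricsFunctionalEquationSign
import Literature.AlgebraicGeometry.Motives.ZetaFunctionalEquationSignEvenDimension
import HarnessLib

/-!
# The SIGN of the functional equation of `Z(X, T)` is well defined: two presentations
# `T^{χ⁻}·Ã·B = ε·q^{nχ/2}·T^{χ⁺}·A·B̃` of the same non-zero `Z` have the same `ε`; hence «the sign of `Z(ℰ)` IS `−1`»
# for the elliptic quadric, `+1` for the hyperbolic one, and `(−1)^{b_d}·sgn det(F | Hᵈ(X))` in even dimension `d`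

Topic `Literature/AlgebraicGeometry/Motives`; THEOREMS ONLY (no definition, no instance, no named fact; D-0026).

The tree's `Motives/ZetaFunction.HasFunctionalEquation q n Z χ` (Weil 1949; Hartshorne App. C Thm. 4.4) hides the
sign `ε = ±1` of `Z(1/(qⁿT)) = ε·q^{nχ/2}·T^χ·Z(T)` in an existential over rational presentations `Z·B = A`
(`B(0) ≠ 0`, `deg A, deg B ≤ N`) of the cross-multiplied identity
`T^{χ⁻}·Ã·B = ε·q^{nχ/2}·T^{χ⁺}·A·B̃` (`Ã = T^N A(1/(qⁿT))`, `B̃ = T^N B(1/(qⁿT))`).  Row g51-#12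
(`Motives/QuadricsFunctionalEquationSign`) could therefore only say that the functional equation of the elliptic
quadric «holds with `ε = −1`» (FREE POINTER (ε) of generation 51).  This file proves that `ε` does not depend on the
presentation (**`functionalEquation_sign_unique`**, §1: from `Z·B = A`, `Z·B' = A'` one gets `A·B' = A'·B`, and
`reflectScale` is multiplicative, so the two identities multiply out to `ε·M = ε'·M` with
`M = q^{nχ/2}·T^{χ⁺}·A·A'·B̃·B̃' ≠ 0`), and draws the consequences:

* §2 (`E` a Galois Weil cohomology over `𝔽_q` with the Lefschetz trace formula and `χ(φ) = q`; `X` smooth projective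
  of EVEN dimension `d`; NO Riemann hypothesis): **`functionalEquation_sign_eq_of_even`** — if
  `det(F | Hᵈ(X)) = ε_d·q^{d·b_d/2}` (`ε_d = ±1` exists, the tree's `exists_sign_det_frobAction_middle_of_even`), then
  EVERY presentation of the functional equation of `Z(X, T)` with `χ = χ(X)` has the sign `(−1)^{b_d}·ε_d` («a sign
  `ε` that arises from the central cohomology group», Kahn (3.6.6), made unique).
* §3 (E-free) the quadrics of `ℙ^{2l+3}` over `𝔽_q`: **`functionalEquation_ellipticQuadric_sign_eq_neg_one`** — every
  presentation of the functional equation of `Z(ℰ_{2l+3}, T)` (`χ = 2l+4`) has `ε = −1` («This sign may be `−1`! …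
  a smooth quadric surface», Kahn Remark 3.66, for all `l`); **`functionalEquation_splitQuadric_sign_eq_one`** —
  for the hyperbolic quadric `ℋ_{2l+3}` every presentation has `ε = +1`.
* §4 (`E`-level, from g52-#3) **`det_frobAction_ellipticQuadric_middle`** (`det(F | H^{2l+2}(ℰ)) = −q^{2l+2}`, i.e.
  `ε_d = −1`, `b_d = 2`: the `E`-level sign `(−1)²·(−1) = −1` agrees) and **`det_frobAction_splitQuadric_middle`**
  (`= +q^{2l+2}`), each also in the normal form `ε_d·q^{d·b_d/2}` consumed by §2.

What is NOT here: the uniqueness of `χ` (for `Z(0) = 1` one also has `χ = deg B − deg A`; the tree proves this for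
its own presentation, `natDegree_sub_natDegree_eq_eulerChar`).  HC is not touched.

## References

* [Kahn2020] B. Kahn, Zeta and L-Functions of Varieties and Motives, LMS LNS 462 (2020), §3.6 (3.6.5)–(3.6.6),
  Remark 3.66; §6.13 Prop. 6.46 (3), Th. 6.50.
* [Hartshorne1977] R. Hartshorne, Algebraic Geometry, GTM 52 (1977), App. C §1 (1.2), Thm. 4.4.
* [Weil1949] A. Weil, Numbers of solutions of equations in finite fields, Bull. AMS 55 (1949), p. 507.
* [Hirschfeld1998] J. W. P. Hirschfeld, Projective Geometries over Finite Fields (1998), §5.2 Thm. 5.2.6.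
* Tree: `Motives/ZetaFunction` (`HasFunctionalEquation`, `reflectScale`), `Motives/QuadricsFunctionalEquationSign`
  (g51-#12: `reflectScale_mul_of_natDegree_le`, `functionalEquation_ellipticQuadric_sign_neg_one`,
  `functionalEquation_splitQuadric_sign_one`), `Motives/ZetaFunctionalEquationSignEvenDimension`
  (`functionalEquation_zetaSeries_sign_of_even`, `exists_polynomial_mul_zetaSeries_eq_of_hasLefschetzTraceFormula`,
  `natDegree_sub_natDegree_eq_eulerChar`), `Motives/QuadricsFiniteFieldCohomology` (g52-#3: the charpolys).

## Provenance

Lane `lit-hodgefound` (summit `HodgeConjecture`, Track 2 foundations library, Layer B: motives ∕ zeta functions),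
seat `lit-hodgefound-p29` (literature-prover, generation 52, row g52-#4; FREE POINTER (ε) of generation 51).
-/

universe u v

open Polynomial Finset CategoryTheory AlgebraicGeometry

noncomputable section

namespace Literature.AlgebraicGeometry.Motives

/-! ### §1 Two presentations of a functional equation have the same sign -/

section Pure

/-- **The top coefficient of `T^N p(c/T)` is `p(0)`**: `(reflectScale N c p).coeff N = p.coeff 0`.
[cite: Hartshorne1977, App. C §1 (1.2)] -/
theorem coeff_reflectScale_self {R : Type*} [CommSemiring R] (N : ℕ) (c : R) (p : R[X]) :
    (reflectScale N c p).coeff N = p.coeff 0 := by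
  rw [reflectScale, coeff_reflect, revAt_le le_rfl, Nat.sub_self, coeff_zero_eq_eval_zero, coeff_zero_eq_eval_zero,
    eval_comp, eval_mul, eval_C, eval_X, mul_zero]

/-- `T^N p(c/T) ≠ 0` as soon as `p(0) ≠ 0`. [cite: Hartshorne1977, App. C §1 (1.2)] -/
theorem reflectScale_ne_zero_of_coeff_zero_ne_zero {R : Type*} [CommSemiring R] (N : ℕ) (c : R) {p : R[X]}
    (hp : p.coeff 0 ≠ 0) : reflectScale N c p ≠ 0 := by
  intro h
  apply hp
  rw [← coeff_reflectScale_self N c p, h, coeff_zero]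

/-- **The sign of the functional equation is independent of the presentation.**  Let `Z ∈ ℚ⟦T⟧`, `Z ≠ 0`, and
let `Z·B = A`, `Z·B' = A'` be two rational presentations (`B(0), B'(0) ≠ 0`, `deg A, deg B ≤ N`, `deg A', deg B' ≤ N'`)
satisfying the cross-multiplied functional equation `T^{χ⁻}·Ã·B = ε·q^{nχ/2}·T^{χ⁺}·A·B̃` with signs `ε`, `ε'`
(`Ã = T^N A(1/(qⁿT))` etc., as in `HasFunctionalEquation q n Z χ`; `q > 0`).  Then `ε = ε'`: indeed `A·B' = A'·B`,
`Ã·B̃' = Ã'·B̃` (both are `T^{N+N'}(A B')(1/(qⁿT))`), and multiplying the two identities crosswise gives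
`ε·M = ε'·M` with `M = q^{nχ/2}·T^{χ⁺}·A·A'·B̃·B̃' ≠ 0`.  (Stated for arbitrary real constants `e`, `e'` in
front of `q^{nχ/2}`; the signs `ε = ±1` of `HasFunctionalEquation` are the case `e = ε`.)
[cite: Kahn2020, §3.6 (3.6.6)] [cite: Hartshorne1977, App. C Thm. 4.4] -/
theorem functionalEquation_sign_unique {q n : ℕ} (hq : 0 < q) {Z : PowerSeries ℚ} (hZ0 : Z ≠ 0) {χ : ℤ}
    {A B : ℚ[X]} {N : ℕ} {e : ℝ} (hB0 : B.coeff 0 ≠ 0) (hZ : Z * (B : PowerSeries ℚ) = A)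
    (hA : A.natDegree ≤ N) (hB : B.natDegree ≤ N)
    (hfe : X ^ (-χ).toNat * (reflectScale N ((q : ℚ) ^ n)⁻¹ A).map (algebraMap ℚ ℝ) * B.map (algebraMap ℚ ℝ) =
      C (e * (q : ℝ) ^ ((n : ℝ) * χ / 2)) * X ^ χ.toNat *
        A.map (algebraMap ℚ ℝ) * (reflectScale N ((q : ℚ) ^ n)⁻¹ B).map (algebraMap ℚ ℝ))
    {A' B' : ℚ[X]} {N' : ℕ} {e' : ℝ} (hB0' : B'.coeff 0 ≠ 0) (hZ' : Z * (B' : PowerSeries ℚ) = A')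
    (hA' : A'.natDegree ≤ N') (hB' : B'.natDegree ≤ N')
    (hfe' : X ^ (-χ).toNat * (reflectScale N' ((q : ℚ) ^ n)⁻¹ A').map (algebraMap ℚ ℝ) * B'.map (algebraMap ℚ ℝ) =
      C (e' * (q : ℝ) ^ ((n : ℝ) * χ / 2)) * X ^ χ.toNat *
        A'.map (algebraMap ℚ ℝ) * (reflectScale N' ((q : ℚ) ^ n)⁻¹ B').map (algebraMap ℚ ℝ)) :
    e = e' := by
  set f := algebraMap ℚ ℝ with hf
  set c : ℚ := ((q : ℚ) ^ n)⁻¹ with hc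
  have hfi : Function.Injective f := (algebraMap ℚ ℝ).injective
  -- `A B' = A' B`
  have hAB : A * B' = A' * B := by
    apply Polynomial.coe_injective (R := ℚ)
    rw [Polynomial.coe_mul, Polynomial.coe_mul, ← hZ, ← hZ']
    ring
  -- `Ã B̃' = Ã' B̃`
  have hrefl : reflectScale N c A * reflectScale N' c B' = reflectScale N' c A' * reflectScale N c B := by
    rw [← reflectScale_mul_of_natDegree_le hA hB', hAB, add_comm, reflectScale_mul_of_natDegree_le hA' hB]
  -- non-vanishing
  have hBne : B ≠ 0 := fun h => hB0 (by rw [h, coeff_zero])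
  have hB'ne : B' ≠ 0 := fun h => hB0' (by rw [h, coeff_zero])
  have hAne : A ≠ 0 := by
    intro h
    rw [h, Polynomial.coe_zero, mul_eq_zero] at hZ
    rcases hZ with h1 | h1
    · exact hZ0 h1
    · exact hBne (Polynomial.coe_injective (R := ℚ) (h1.trans Polynomial.coe_zero.symm))
  have hA'ne : A' ≠ 0 := by
    intro h
    rw [h, Polynomial.coe_zero, mul_eq_zero] at hZ'
    rcases hZ' with h1 | h1
    · exact hZ0 h1
    · exact hB'ne (Polynomial.coe_injective (R := ℚ) (h1.trans Polynomial.coe_zero.symm))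
  have hBt : reflectScale N c B ≠ 0 := reflectScale_ne_zero_of_coeff_zero_ne_zero N c hB0
  have hBt' : reflectScale N' c B' ≠ 0 := reflectScale_ne_zero_of_coeff_zero_ne_zero N' c hB0'
  have hM : X ^ χ.toNat * A.map f * A'.map f * (reflectScale N c B).map f * (reflectScale N' c B').map f ≠ 0 := by
    refine mul_ne_zero (mul_ne_zero (mul_ne_zero (mul_ne_zero (pow_ne_zero _ X_ne_zero) ?_) ?_) ?_) ?_
    · exact (Polynomial.map_ne_zero_iff hfi).mpr hAne
    · exact (Polynomial.map_ne_zero_iff hfi).mpr hA'ne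
    · exact (Polynomial.map_ne_zero_iff hfi).mpr hBt
    · exact (Polynomial.map_ne_zero_iff hfi).mpr hBt'
  -- images in `ℝ[T]`
  have hAB_R : A.map f * B'.map f = A'.map f * B.map f := by
    rw [← Polynomial.map_mul, hAB, Polynomial.map_mul]
  have hrefl_R : (reflectScale N c A).map f * (reflectScale N' c B').map f =
      (reflectScale N' c A').map f * (reflectScale N c B).map f := by
    rw [← Polynomial.map_mul, hrefl, Polynomial.map_mul]
  -- `ε M = ε' M`
  have key : C (e * (q : ℝ) ^ ((n : ℝ) * χ / 2)) *
      (X ^ χ.toNat * A.map f * A'.map f * (reflectScale N c B).map f * (reflectScale N' c B').map f) =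
      C (e' * (q : ℝ) ^ ((n : ℝ) * χ / 2)) *
      (X ^ χ.toNat * A.map f * A'.map f * (reflectScale N c B).map f * (reflectScale N' c B').map f) := by
    linear_combination (-(A'.map f * (reflectScale N' c B').map f)) * hfe
      + (A.map f * (reflectScale N c B).map f) * hfe'
      + (X ^ (-χ).toNat * B.map f * A'.map f) * hrefl_R
      - (X ^ (-χ).toNat * (reflectScale N' c A').map f * (reflectScale N c B).map f) * hAB_R
  have hC := mul_right_cancel₀ hM key
  have hκ : (0 : ℝ) < (q : ℝ) ^ ((n : ℝ) * χ / 2) := Real.rpow_pos_of_pos (by exact_mod_cast hq) _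
  exact mul_right_cancel₀ hκ.ne' (C_injective hC)

end Pure

/-! ### §2 Even dimension: every presentation has the sign `(−1)^{b_d} · sgn det(F | Hᵈ(X))` -/

namespace GaloisWeilCohomology

variable {k : Type u} [Field k] [Finite k] {K : Type v} [Field K] [CharZero K]
  {χ : Field.absoluteGaloisGroup k →* Kˣ} (E : GaloisWeilCohomology k K χ)

section Even

variable {d : ℕ} {X : SchemeOver k}

/-- **The sign of the functional equation of `Z(X, T)` is `(−1)^{b_d}·ε_d` in EVERY presentation**, for `X` smooth
projective of EVEN dimension `d` over `𝔽_q` with `det(F | Hᵈ(X)) = ε_d·q^{d·b_d/2}` (`E` with the Lefschetz trace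
formula and `χ(φ) = q`; no Riemann hypothesis): if `Z(X,T)·B = A` (`B(0) ≠ 0`, `deg A, deg B ≤ N`) satisfies the
cross-multiplied functional equation with Euler characteristic `χ(X) = Σᵢ(−1)ⁱbᵢ` and sign `ε`, then
`ε = (−1)^{b_d}·ε_d` (as integers) — «a sign `ε` that arises from the central cohomology group», now independent of the
presentation (§1 applied to the tree's `functionalEquation_zetaSeries_sign_of_even`).
[cite: Kahn2020, §3.6 (3.6.6) and Remark 3.66] [cite: Kahn2020, §6.13 Th. 6.50] [cite: Hartshorne1977, App. C Thm. 4.4] -/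
theorem functionalEquation_sign_eq_of_even (hE : E.HasLefschetzTraceFormula)
    (hχ : ((χ (arithFrob k) : Kˣ) : K) = Nat.card k) (hX : IsSmoothProjective d X) (hd : Even d)
    {εd : ℤˣ} (hεd : LinearMap.det (E.frobAction X d) =
      (εd : ℤ) * (Nat.card k : K) ^ (d * (haveI := E.finite_obj hX d; Module.finrank K (E.obj X d)) / 2))
    {A B : ℚ[X]} {N : ℕ} {ε : ℤˣ} (hB0 : B.coeff 0 ≠ 0) (hZ : zetaSeries X * (B : PowerSeries ℚ) = A)
    (hA : A.natDegree ≤ N) (hB : B.natDegree ≤ N)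
    (hfe : Polynomial.X ^ (-(∑ i ∈ Finset.range (2 * d + 1), (-1 : ℤ) ^ i * (Module.finrank K (E.obj X i) : ℤ))).toNat *
        (reflectScale N ((Nat.card k : ℚ) ^ d)⁻¹ A).map (algebraMap ℚ ℝ) * B.map (algebraMap ℚ ℝ) =
      C (((ε : ℤ) : ℝ) * (Nat.card k : ℝ) ^ ((d : ℝ) *
          (((∑ i ∈ Finset.range (2 * d + 1), (-1 : ℤ) ^ i * (Module.finrank K (E.obj X i) : ℤ) : ℤ)) : ℝ) / 2)) *
        Polynomial.X ^ (∑ i ∈ Finset.range (2 * d + 1), (-1 : ℤ) ^ i * (Module.finrank K (E.obj X i) : ℤ)).toNat *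
        A.map (algebraMap ℚ ℝ) * (reflectScale N ((Nat.card k : ℚ) ^ d)⁻¹ B).map (algebraMap ℚ ℝ)) :
    (ε : ℤ) = (-1) ^ (haveI := E.finite_obj hX d; Module.finrank K (E.obj X d)) * (εd : ℤ) := by
  haveI := E.finite_obj hX d
  -- the tree's presentation with the sign `(−1)^{b_d} ε_d`
  obtain ⟨A', B', hB0', hZ'⟩ := E.exists_polynomial_mul_zetaSeries_eq_of_hasLefschetzTraceFormula hE hX
  have hfe' := E.functionalEquation_zetaSeries_sign_of_even hE hχ hX hd hεd hB0' hZ'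
  rw [E.natDegree_sub_natDegree_eq_eulerChar hE hχ hX hB0' hZ'] at hfe'
  have hZ0 : zetaSeries X ≠ 0 := by
    intro h
    have h1 := constantCoeff_zetaSeries (X := X)
    rw [h, map_zero] at h1
    exact zero_ne_one h1
  have h := functionalEquation_sign_unique Nat.card_pos hZ0 hB0 hZ hA hB hfe hB0' hZ'
    (le_max_left _ _) (le_max_right _ _) hfe'
  exact_mod_cast h

end Even

end GaloisWeilCohomology

/-! ### §3 The quadrics of `ℙ^{2l+3}`: the sign IS `−1` for `ℰ`, `+1` for `ℋ` -/

section Quadrics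

open SmoothHypersurface (hypersurface)

variable {k : Type u} [Field k] [Finite k] (l : ℕ)

/-- `l + 1 ≤ 2l + 2 + 2` (any proof matches the tree's by proof irrelevance). [folklore] -/
private theorem leE' (l : ℕ) : l + 1 ≤ 2 * l + 2 + 2 := by omega

/-- The middle coordinate `l + 1`. [folklore] -/
private theorem ltE₁' (l : ℕ) : l + 1 < 2 * l + 2 + 2 := by omega

/-- The middle coordinate `l + 2`. [folklore] -/
private theorem ltE₂' (l : ℕ) : l + 2 < 2 * l + 2 + 2 := by omega

/-- `l + 2 ≤ 2l + 2 + 2`. [folklore] -/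
private theorem leS' (l : ℕ) : l + 2 ≤ 2 * l + 2 + 2 := by omega

/-- A zeta function is not zero (`Z(X, 0) = 1`). [folklore] -/
private theorem zetaSeries_ne_zero' (X : SchemeOver k) : zetaSeries X ≠ 0 := by
  intro h
  have h1 := constantCoeff_zetaSeries (X := X)
  rw [h, map_zero] at h1
  exact zero_ne_one h1

/-- `deg ∏_{i<m}(1 − qⁱT) ≤ m`. [folklore] -/
private theorem natDegree_prod_range_one_sub_le (q : ℚ) (m : ℕ) :
    (∏ i ∈ range m, (1 - C (q ^ i) * X : ℚ[X])).natDegree ≤ m := by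
  refine (natDegree_prod_le _ _).trans ?_
  calc ∑ i ∈ range m, (1 - C (q ^ i) * X : ℚ[X]).natDegree ≤ ∑ _i ∈ range m, 1 :=
        sum_le_sum fun i _ => by
          rw [sub_eq_add_neg, ← neg_mul, ← C_neg, add_comm, ← C_1]
          exact natDegree_linear_le
    _ = m := by rw [sum_const, card_range, smul_eq_mul, mul_one]

/-- `deg (∏_{i≤2l+2}(1 − qⁱT) · (1 + cT)) ≤ 2l+4`, `(…)(0) ≠ 0`, and `↑(∏ …) = ∏ ↑(…)`: the denominator of g51-#12's
presentation of `Z(ℰ)` ∕ `Z(ℋ)` (with `c = ± q^{l+1}`). [folklore] -/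
private theorem denominator_aux (q c : ℚ) :
    ((∏ i ∈ range (2 * l + 3), (1 - C (q ^ i) * X : ℚ[X])) * (1 + C c * X)).natDegree ≤ 2 * l + 4 ∧
      ((∏ i ∈ range (2 * l + 3), (1 - C (q ^ i) * X : ℚ[X])) * (1 + C c * X)).coeff 0 ≠ 0 ∧
      ((((∏ i ∈ range (2 * l + 3), (1 - C (q ^ i) * X : ℚ[X])) * (1 + C c * X) : ℚ[X])) : PowerSeries ℚ) =
        (∏ i ∈ range (2 * l + 3), (((1 - C (q ^ i) * X : ℚ[X])) : PowerSeries ℚ)) *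
          (((1 + C c * X : ℚ[X])) : PowerSeries ℚ) := by
  refine ⟨natDegree_mul_le.trans ?_, ?_, ?_⟩
  · have h1 := natDegree_prod_range_one_sub_le q (2 * l + 3)
    have h2 : (1 + C c * X : ℚ[X]).natDegree ≤ 1 := by rw [add_comm, ← C_1]; exact natDegree_linear_le
    omega
  · rw [coeff_zero_eq_eval_zero, eval_mul, eval_prod]
    simp
  · rw [Polynomial.coe_mul, ← Polynomial.coeToPowerSeries.ringHom_apply, map_prod]
    simp only [Polynomial.coeToPowerSeries.ringHom_apply]

/-- **The sign of the functional equation of the elliptic quadric `ℰ_{2l+3} ⊂ ℙ^{2l+3}_{𝔽_q}` IS `−1`**: for EVERY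
rational presentation `Z(ℰ,T)·B = A` (`B(0) ≠ 0`, `deg A, deg B ≤ N`) satisfying the cross-multiplied functional
equation with `χ = χ(ℰ) = 2l+4` and sign `ε`, one has `ε = −1` — g51-#12's presentation has `ε = −1` and the sign
is unique (§1).  «This sign may be `−1`! … a smooth quadric surface» — here for every `l`, and now as a property of
`Z(ℰ, T)` rather than of one presentation. [cite: Kahn2020, §3.6 Remark 3.66 and (3.6.6)]
[cite: Hirschfeld1998, §5.2 Thm. 5.2.6 (iii)] -/
theorem functionalEquation_ellipticQuadric_sign_eq_neg_one {ε₀ : k} (hε₀ : ¬IsSquare ε₀)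
    {A B : ℚ[X]} {N : ℕ} {ε : ℤˣ} (hB0 : B.coeff 0 ≠ 0)
    (hZ : zetaSeries
        (hypersurface ((∑ i : Fin (l + 1), MvPolynomial.X (Fin.castLE (leE' l) i) *
          MvPolynomial.X (Fin.rev (Fin.castLE (leE' l) i))) + MvPolynomial.X (Fin.mk (l + 1) (ltE₁' l)) ^ 2 -
          MvPolynomial.C ε₀ * MvPolynomial.X (Fin.mk (l + 2) (ltE₂' l)) ^ 2 : MvPolynomial (Fin (2 * l + 2 + 2)) k)) * (B : PowerSeries ℚ) = A)
    (hA : A.natDegree ≤ N) (hB : B.natDegree ≤ N)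
    (hfe : X ^ (-(((2 * l + 4 : ℕ)) : ℤ)).toNat *
        (reflectScale N ((Nat.card k : ℚ) ^ (2 * l + 2))⁻¹ A).map (algebraMap ℚ ℝ) * B.map (algebraMap ℚ ℝ) =
      C (((ε : ℤ) : ℝ) * (Nat.card k : ℝ) ^ (((2 * l + 2 : ℕ) : ℝ) * ((((2 * l + 4 : ℕ)) : ℤ) : ℝ) / 2)) *
        X ^ ((((2 * l + 4 : ℕ)) : ℤ)).toNat * A.map (algebraMap ℚ ℝ) *
        (reflectScale N ((Nat.card k : ℚ) ^ (2 * l + 2))⁻¹ B).map (algebraMap ℚ ℝ)) :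
    ε = -1 := by
  obtain ⟨hdeg, h0, hcoe⟩ := denominator_aux l (Nat.card k : ℚ) ((Nat.card k : ℚ) ^ (l + 1))
  have hZ' : zetaSeries
        (hypersurface ((∑ i : Fin (l + 1), MvPolynomial.X (Fin.castLE (leE' l) i) *
          MvPolynomial.X (Fin.rev (Fin.castLE (leE' l) i))) + MvPolynomial.X (Fin.mk (l + 1) (ltE₁' l)) ^ 2 -
          MvPolynomial.C ε₀ * MvPolynomial.X (Fin.mk (l + 2) (ltE₂' l)) ^ 2 : MvPolynomial (Fin (2 * l + 2 + 2)) k)) *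
      ((((∏ i ∈ range (2 * l + 3), (1 - C ((Nat.card k : ℚ) ^ i) * X : ℚ[X])) *
          (1 + C ((Nat.card k : ℚ) ^ (l + 1)) * X) : ℚ[X])) : PowerSeries ℚ) = ((1 : ℚ[X]) : PowerSeries ℚ) := by
    rw [hcoe, Polynomial.coe_one]
    exact zetaSeries_ellipticQuadric_mul_prod l hε₀
  have h := functionalEquation_sign_unique (n := 2 * l + 2) Nat.card_pos (zetaSeries_ne_zero' _) hB0 hZ hA hB hfe
    h0 hZ' (by rw [natDegree_one]; exact Nat.zero_le _) hdeg (functionalEquation_ellipticQuadric_sign_neg_one l)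
  exact Units.ext (by exact_mod_cast h)

/-- **The sign of the functional equation of the hyperbolic quadric `ℋ_{2l+3}` IS `+1`**: every presentation of
the functional equation of `Z(ℋ, T)` (`χ = 2l+4`) has `ε = 1`. [cite: Kahn2020, §3.6 (3.6.6) and Remark 3.66]
[cite: Hirschfeld1998, §5.2 Thm. 5.2.6 (ii)] -/
theorem functionalEquation_splitQuadric_sign_eq_one (ε₁ : Fin (l + 2) → kˣ)
    {A B : ℚ[X]} {N : ℕ} {ε : ℤˣ} (hB0 : B.coeff 0 ≠ 0)
    (hZ : zetaSeries
        (hypersurface (∑ i : Fin (l + 2), MvPolynomial.C (ε₁ i : k) * MvPolynomial.X (Fin.castLE (leS' l) i) *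
          MvPolynomial.X (Fin.rev (Fin.castLE (leS' l) i)) : MvPolynomial (Fin (2 * l + 2 + 2)) k)) * (B : PowerSeries ℚ) = A)
    (hA : A.natDegree ≤ N) (hB : B.natDegree ≤ N)
    (hfe : X ^ (-(((2 * l + 4 : ℕ)) : ℤ)).toNat *
        (reflectScale N ((Nat.card k : ℚ) ^ (2 * l + 2))⁻¹ A).map (algebraMap ℚ ℝ) * B.map (algebraMap ℚ ℝ) =
      C (((ε : ℤ) : ℝ) * (Nat.card k : ℝ) ^ (((2 * l + 2 : ℕ) : ℝ) * ((((2 * l + 4 : ℕ)) : ℤ) : ℝ) / 2)) *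
        X ^ ((((2 * l + 4 : ℕ)) : ℤ)).toNat * A.map (algebraMap ℚ ℝ) *
        (reflectScale N ((Nat.card k : ℚ) ^ (2 * l + 2))⁻¹ B).map (algebraMap ℚ ℝ)) :
    ε = 1 := by
  obtain ⟨hdeg, h0, hcoe⟩ := denominator_aux l (Nat.card k : ℚ) (-((Nat.card k : ℚ) ^ (l + 1)))
  have hsub : (1 + C (-((Nat.card k : ℚ) ^ (l + 1))) * X : ℚ[X]) = 1 - C ((Nat.card k : ℚ) ^ (l + 1)) * X := by
    rw [map_neg]; ring
  rw [hsub] at hdeg h0 hcoe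
  have hZ' : zetaSeries
        (hypersurface (∑ i : Fin (l + 2), MvPolynomial.C (ε₁ i : k) * MvPolynomial.X (Fin.castLE (leS' l) i) *
          MvPolynomial.X (Fin.rev (Fin.castLE (leS' l) i)) : MvPolynomial (Fin (2 * l + 2 + 2)) k)) *
      ((((∏ i ∈ range (2 * l + 3), (1 - C ((Nat.card k : ℚ) ^ i) * X : ℚ[X])) *
          (1 - C ((Nat.card k : ℚ) ^ (l + 1)) * X) : ℚ[X])) : PowerSeries ℚ) = ((1 : ℚ[X]) : PowerSeries ℚ) := by
    rw [hcoe, Polynomial.coe_one]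
    exact zetaSeries_splitQuadric_mul_prod l ε₁
  have h := functionalEquation_sign_unique (n := 2 * l + 2) Nat.card_pos (zetaSeries_ne_zero' _) hB0 hZ hA hB hfe
    h0 hZ' (by rw [natDegree_one]; exact Nat.zero_le _) hdeg (functionalEquation_splitQuadric_sign_one (k := k) l)
  exact Units.ext (by exact_mod_cast h)

end Quadrics

/-! ### §4 `E`-level: `det(F | H^{2l+2}) = −q^{2l+2}` for `ℰ`, `+q^{2l+2}` for `ℋ` -/

namespace GaloisWeilCohomology

open SmoothHypersurface (hypersurface)

variable {k : Type u} [Field k] [Finite k] {K : Type v} [Field K] [CharZero K]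
  {χ : Field.absoluteGaloisGroup k →* Kˣ} (E : GaloisWeilCohomology k K χ) (l : ℕ)

/-- **`det(F | H^{2l+2}(ℰ)) = −q^{2l+2}`**: the two eigenvalues `q^{l+1}`, `−q^{l+1}` (g52-#3
`charpoly_frobAction_ellipticQuadric_middle`); in the normal form `ε_d·q^{d·b_d/2}` of §2 this is `ε_d = −1`
(`d = 2l+2`, `b_d = 2`), so the `E`-level sign `(−1)^{b_d}·ε_d = −1` agrees with the `E`-free one (§3).
[cite: Kahn2020, §3.6 Remark 3.66] [cite: Kahn2020, §6.13 Prop. 6.46 (3)] -/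
theorem det_frobAction_ellipticQuadric_middle (hE : E.HasLefschetzTraceFormula)
    (hχ : ((χ (arithFrob k) : Kˣ) : K) = Nat.card k) {ε₀ : k} (hε₀ : ¬IsSquare ε₀)
    (hRH : E.WeilRiemannHypothesisFor
      (hypersurface ((∑ i : Fin (l + 1), MvPolynomial.X (Fin.castLE (leE' l) i) *
          MvPolynomial.X (Fin.rev (Fin.castLE (leE' l) i))) + MvPolynomial.X (Fin.mk (l + 1) (ltE₁' l)) ^ 2 -
          MvPolynomial.C ε₀ * MvPolynomial.X (Fin.mk (l + 2) (ltE₂' l)) ^ 2 : MvPolynomial (Fin (2 * l + 2 + 2)) k)) (2 * l + 2)) :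
    LinearMap.det (E.frobAction
        (hypersurface ((∑ i : Fin (l + 1), MvPolynomial.X (Fin.castLE (leE' l) i) *
          MvPolynomial.X (Fin.rev (Fin.castLE (leE' l) i))) + MvPolynomial.X (Fin.mk (l + 1) (ltE₁' l)) ^ 2 -
          MvPolynomial.C ε₀ * MvPolynomial.X (Fin.mk (l + 2) (ltE₂' l)) ^ 2 : MvPolynomial (Fin (2 * l + 2 + 2)) k)) (2 * (l + 1))) = -((Nat.card k : K) ^ (2 * (l + 1))) ∧
    LinearMap.det (E.frobAction
        (hypersurface ((∑ i : Fin (l + 1), MvPolynomial.X (Fin.castLE (leE' l) i) *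
          MvPolynomial.X (Fin.rev (Fin.castLE (leE' l) i))) + MvPolynomial.X (Fin.mk (l + 1) (ltE₁' l)) ^ 2 -
          MvPolynomial.C ε₀ * MvPolynomial.X (Fin.mk (l + 2) (ltE₂' l)) ^ 2 : MvPolynomial (Fin (2 * l + 2 + 2)) k)) (2 * l + 2)) =
      ((-1 : ℤˣ) : ℤ) * (Nat.card k : K) ^ ((2 * l + 2) *
        (haveI := E.finite_obj (isSmoothProjective_ellipticQuadric_of_not_isSquare l hε₀) (2 * l + 2);
          Module.finrank K (E.obj
            (hypersurface ((∑ i : Fin (l + 1), MvPolynomial.X (Fin.castLE (leE' l) i) *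
          MvPolynomial.X (Fin.rev (Fin.castLE (leE' l) i))) + MvPolynomial.X (Fin.mk (l + 1) (ltE₁' l)) ^ 2 -
          MvPolynomial.C ε₀ * MvPolynomial.X (Fin.mk (l + 2) (ltE₂' l)) ^ 2 : MvPolynomial (Fin (2 * l + 2 + 2)) k)) (2 * l + 2))) / 2) := by
  have hX := isSmoothProjective_ellipticQuadric_of_not_isSquare l hε₀
  haveI := E.finite_obj hX (2 * (l + 1))
  have hdet : LinearMap.det (E.frobAction
      (hypersurface ((∑ i : Fin (l + 1), MvPolynomial.X (Fin.castLE (leE' l) i) *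
          MvPolynomial.X (Fin.rev (Fin.castLE (leE' l) i))) + MvPolynomial.X (Fin.mk (l + 1) (ltE₁' l)) ^ 2 -
          MvPolynomial.C ε₀ * MvPolynomial.X (Fin.mk (l + 2) (ltE₂' l)) ^ 2 : MvPolynomial (Fin (2 * l + 2 + 2)) k)) (2 * (l + 1))) = -((Nat.card k : K) ^ (2 * (l + 1))) := by
    rw [LinearMap.det_eq_sign_charpoly_coeff, E.charpoly_frobAction_ellipticQuadric_middle l hE hχ hε₀ hRH,
      E.finrank_ellipticQuadric_middle l hE hχ hε₀ hRH, coeff_zero_eq_eval_zero, eval_mul, eval_sub, eval_sub, eval_X,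
      eval_C, eval_C]
    ring
  refine ⟨hdet, ?_⟩
  -- `2 * l + 2` and `2 * (l + 1)` are definitionally equal indices
  have hdet' : LinearMap.det (E.frobAction
      (hypersurface ((∑ i : Fin (l + 1), MvPolynomial.X (Fin.castLE (leE' l) i) *
          MvPolynomial.X (Fin.rev (Fin.castLE (leE' l) i))) + MvPolynomial.X (Fin.mk (l + 1) (ltE₁' l)) ^ 2 -
          MvPolynomial.C ε₀ * MvPolynomial.X (Fin.mk (l + 2) (ltE₂' l)) ^ 2 : MvPolynomial (Fin (2 * l + 2 + 2)) k)) (2 * l + 2)) = -((Nat.card k : K) ^ (2 * (l + 1))) := hdet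
  have hb : Module.finrank K (E.obj
      (hypersurface ((∑ i : Fin (l + 1), MvPolynomial.X (Fin.castLE (leE' l) i) *
          MvPolynomial.X (Fin.rev (Fin.castLE (leE' l) i))) + MvPolynomial.X (Fin.mk (l + 1) (ltE₁' l)) ^ 2 -
          MvPolynomial.C ε₀ * MvPolynomial.X (Fin.mk (l + 2) (ltE₂' l)) ^ 2 : MvPolynomial (Fin (2 * l + 2 + 2)) k)) (2 * l + 2)) = 2 := E.finrank_ellipticQuadric_middle l hE hχ hε₀ hRH
  rw [hdet', hb, Units.val_neg, Units.val_one, Int.cast_neg, Int.cast_one, neg_one_mul,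
    show (2 * l + 2) * 2 / 2 = 2 * (l + 1) by omega]

/-- `l + 2 ≤ 2l + 2 + 2`. [folklore] -/
private theorem leS'' (l : ℕ) : l + 2 ≤ 2 * l + 2 + 2 := by omega

/-- **`det(F | H^{2l+2}(ℋ)) = q^{2l+2}`**: the double eigenvalue `q^{l+1}` (g52-#3
`charpoly_frobAction_splitQuadric_two_mul`); `ε_d = +1` in the normal form of §2, `E`-level sign `+1`.
[cite: Kahn2020, §3.6 (3.6.6)] [cite: Kahn2020, §6.13 Prop. 6.46 (3)] -/
theorem det_frobAction_splitQuadric_middle (hE : E.HasLefschetzTraceFormula)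
    (hχ : ((χ (arithFrob k) : Kˣ) : K) = Nat.card k) (ε₁ : Fin (l + 2) → kˣ)
    (hRH : E.WeilRiemannHypothesisFor
      (hypersurface (∑ i : Fin (l + 2), MvPolynomial.C (ε₁ i : k) * MvPolynomial.X (Fin.castLE (leS'' l) i) *
          MvPolynomial.X (Fin.rev (Fin.castLE (leS'' l) i)) : MvPolynomial (Fin (2 * l + 2 + 2)) k)) (2 * l + 2)) :
    LinearMap.det (E.frobAction
        (hypersurface (∑ i : Fin (l + 2), MvPolynomial.C (ε₁ i : k) * MvPolynomial.X (Fin.castLE (leS'' l) i) *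
          MvPolynomial.X (Fin.rev (Fin.castLE (leS'' l) i)) : MvPolynomial (Fin (2 * l + 2 + 2)) k)) (2 * (l + 1))) =
      (Nat.card k : K) ^ (2 * (l + 1)) ∧
    LinearMap.det (E.frobAction
        (hypersurface (∑ i : Fin (l + 2), MvPolynomial.C (ε₁ i : k) * MvPolynomial.X (Fin.castLE (leS'' l) i) *
          MvPolynomial.X (Fin.rev (Fin.castLE (leS'' l) i)) : MvPolynomial (Fin (2 * l + 2 + 2)) k)) (2 * l + 2)) =
      ((1 : ℤˣ) : ℤ) * (Nat.card k : K) ^ ((2 * l + 2) *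
        (haveI := E.finite_obj (isSmoothProjective_splitQuadric l ε₁) (2 * l + 2);
          Module.finrank K (E.obj
            (hypersurface (∑ i : Fin (l + 2), MvPolynomial.C (ε₁ i : k) * MvPolynomial.X (Fin.castLE (leS'' l) i) *
              MvPolynomial.X (Fin.rev (Fin.castLE (leS'' l) i)) : MvPolynomial (Fin (2 * l + 2 + 2)) k)) (2 * l + 2))) /
          2) := by
  have hX := isSmoothProjective_splitQuadric l ε₁
  haveI := E.finite_obj hX (2 * (l + 1))
  have hdet : LinearMap.det (E.frobAction
      (hypersurface (∑ i : Fin (l + 2), MvPolynomial.C (ε₁ i : k) * MvPolynomial.X (Fin.castLE (leS'' l) i) *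
          MvPolynomial.X (Fin.rev (Fin.castLE (leS'' l) i)) : MvPolynomial (Fin (2 * l + 2 + 2)) k)) (2 * (l + 1))) =
      (Nat.card k : K) ^ (2 * (l + 1)) := by
    rw [LinearMap.det_eq_sign_charpoly_coeff, E.charpoly_frobAction_splitQuadric_two_mul l ε₁ hE hχ hRH (by omega),
      E.finrank_splitQuadric_middle l ε₁ hE hχ hRH, if_pos rfl, coeff_zero_eq_eval_zero, eval_pow, eval_sub, eval_X,
      eval_C]
    ring
  refine ⟨hdet, ?_⟩
  have hdet' : LinearMap.det (E.frobAction
      (hypersurface (∑ i : Fin (l + 2), MvPolynomial.C (ε₁ i : k) * MvPolynomial.X (Fin.castLE (leS'' l) i) *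
          MvPolynomial.X (Fin.rev (Fin.castLE (leS'' l) i)) : MvPolynomial (Fin (2 * l + 2 + 2)) k)) (2 * l + 2)) = (Nat.card k : K) ^ (2 * (l + 1)) := hdet
  have hb : Module.finrank K (E.obj
      (hypersurface (∑ i : Fin (l + 2), MvPolynomial.C (ε₁ i : k) * MvPolynomial.X (Fin.castLE (leS'' l) i) *
          MvPolynomial.X (Fin.rev (Fin.castLE (leS'' l) i)) : MvPolynomial (Fin (2 * l + 2 + 2)) k)) (2 * l + 2)) = 2 := E.finrank_splitQuadric_middle l ε₁ hE hχ hRH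
  rw [hdet', hb, Units.val_one, Int.cast_one, one_mul, show (2 * l + 2) * 2 / 2 = 2 * (l + 1) by omega]

end GaloisWeilCohomology

end Literature.AlgebraicGeometry.Motives

end
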